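import Literature.MathematicalPhysics.QuantumManyBody.PeriodicMaxFormSimplicity
import Summits.AtomisticToContinuum.BoseEinsteinCondensation.Theorems.BECConjugateDominationHardCoreExtensionMaxFormSimpleOfPositive
import Literature.MathematicalPhysics.QuantumManyBody.PeriodicMaxFormBoundHardCore
import Literature.MathematicalPhysics.QuantumManyBody.PeriodicHardCoreFormData
import Literature.MathematicalPhysics.QuantumManyBody.PeriodicHardCoreCutoffState
import Literature.MathematicalPhysics.QuantumManyBody.PeriodicHardCoreTube
import Literature.MathematicalPhysics.QuantumManyBody.PeriodizedPotentialNearestImage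
import Literature.Analysis.FunctionSpaces.TorusHardCoreCutoff
import Literature.Analysis.FunctionSpaces.TorusHardCoreCutoffEnergy
import Literature.Analysis.FunctionSpaces.TorusLineACLSpectral
import HarnessLib

/-!
# Tools for the weighted log-gradient bound — support file (Parts A, B, D) of stub
# `stub_weightedLogGradientBound` (P2a) of line `third-law-current-floor`, crux `BECConjugateDomination.HardCoreExtension`
# (stmt-AtomisticToContinuum-11786)

Faris–Simon positivity of a non-negative ground state `η` of the periodic `N`-boson MAXIMAL form for pair potentials
that are NOT integrable at the origin (soft cores `r^{-p}`, `p ≥ 3`) cannot use the tree's log test function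
`(η + ε)⁻¹` (its potential energy is `+∞`). This file collects the three ingredients of the proof of `stub_weightedLogGradientBound` (for the cut-off test
function `ξ = χ²/(η + ε)`, `χ` the smooth symmetric pair cut-off of `TorusHardCoreCutoff`, the weak coordinate
derivatives `H` of `log(1 + η/ε)` obey `∫ χ² |H|² ≤ C` with `C` independent of `ε`) that do not involve difference
quotients; the assembly with the weighted increment comparison principle is the sequel file
`…WeightedLogGradientBound.lean`.

* Part A: the Euler–Lagrange equation of a maximal-form ground state WITHOUT `W ∈ L¹`
  (`maxFormKinB_add_maxFormPotB_eq_c2`; the potential bookkeeping only needs finite potential energies, and the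
  maximal-form bound is the finite-range one `periodicGroundStateEnergy_mul_le_maxForm_finiteRange`).
* Part B: the test class `ξ = χ² (|η| + ε)⁻¹ ∈ L²` — Bose-symmetric, with finite directional spectral energies
  (Leibniz rule for the coordinate-Lipschitz multiplier `χ²`, `Torus.tsum_sq_mul_enorm_mFourierCoeff_mul_le`).
* Part D: `W ≤ N² M` on `{χ ≠ 0}` for `v` bounded on every `(δ', ∞)` and of range `R₀ < L/2` (nearest image).

References: W. Faris, B. Simon, Duke Math. J. 42 (1975) 559–567, Thm. 1; M. Reed, B. Simon IV (1978), Thm XIII.48;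
D. Gilbarg, N. Trudinger (2001), Thm. 8.19 (the logarithm of a weak supersolution).
-/

noncomputable section

namespace Summit.AtomisticToContinuum.BoseEinsteinCondensation.Cruxes.HardCoreExtension.ThirdLawCurrentFloorAlt

open MeasureTheory Filter UnitAddTorus
open scoped ENNReal NNReal BigOperators Topology InnerProductSpace ComplexConjugate
open Literature.MathematicalPhysics.QuantumManyBody.BoseGas
open Literature.Analysis.FunctionSpaces

attribute [local instance] Literature.MathematicalPhysics.QuantumManyBody.BoseGas.formDomain_measureSpace
  Literature.MathematicalPhysics.QuantumManyBody.BoseGas.formDomain_isProbabilityMeasure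
  Literature.MathematicalPhysics.QuantumManyBody.BoseGas.formDomain_isProbabilityMeasure_pi

/-- Local notation for `L²((ℝ/ℤ)^{3N})` (Haar probability measure), as in the tree files. -/
local notation "L2T " N':max => Lp ℂ 2 (volume : Measure (UnitAddTorus (Fin N' × Fin 3)))

variable {N : ℕ} {L : ℝ} {v : ℝ → ℝ≥0∞}

/-! ## Part A — the Euler–Lagrange equation without `W ∈ L¹` -/

section PartA

/-- **The potential part of a class of finite potential energy is a Bochner integral** (no integrability of
`W` needed: the integrand `W|η|²` is a.e. finite because its integral is). [folklore] -/
theorem integrable_of_maxFormPot_ne_top_c2 (hv : Measurable v) {η : L2T N} (h : maxFormPot v L η ≠ ⊤) :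
    Integrable (fun t : UnitAddTorus (Fin N × Fin 3) => (periodicInteraction v L (fromUnitTorusN L t)).toReal *
      ‖(η : UnitAddTorus (Fin N × Fin 3) → ℂ) t‖ ^ 2) volume ∧
    (maxFormPot v L η).toReal = ∫ t, (periodicInteraction v L (fromUnitTorusN L t)).toReal *
      ‖(η : UnitAddTorus (Fin N × Fin 3) → ℂ) t‖ ^ 2 := by
  have hpt : ∀ t : UnitAddTorus (Fin N × Fin 3), (periodicInteraction v L (fromUnitTorusN L t) *
      ((‖(η : UnitAddTorus (Fin N × Fin 3) → ℂ) t‖₊ : ℝ≥0∞)) ^ 2).toReal =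
      (periodicInteraction v L (fromUnitTorusN L t)).toReal * ‖(η : UnitAddTorus (Fin N × Fin 3) → ℂ) t‖ ^ 2 := by
    intro t
    rw [ENNReal.toReal_mul, coe_nnnorm_sq_eq_ofReal, ENNReal.toReal_ofReal (sq_nonneg _)]
  have hint := integrable_toReal_of_lintegral_ne_top (aemeasurable_pot_integrand hv L η) h
  simp only [hpt] at hint
  refine ⟨hint, ?_⟩
  unfold maxFormPot
  rw [← integral_toReal (aemeasurable_pot_integrand hv L η) (ae_lt_top' (aemeasurable_pot_integrand hv L η) h)]
  exact integral_congr_ae (Eventually.of_forall hpt)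

/-- The potential bilinear integrand is integrable for classes of finite potential energy. [folklore] -/
theorem integrable_maxFormPotB_c2 (hv : Measurable v) {η ξ : L2T N} (hη : maxFormPot v L η ≠ ⊤)
    (hξ : maxFormPot v L ξ ≠ ⊤) :
    Integrable (fun t : UnitAddTorus (Fin N × Fin 3) => (periodicInteraction v L (fromUnitTorusN L t)).toReal *
      (conj ((η : UnitAddTorus (Fin N × Fin 3) → ℂ) t) * (ξ : UnitAddTorus (Fin N × Fin 3) → ℂ) t).re) volume := by
  refine Integrable.mono' ((integrable_of_maxFormPot_ne_top_c2 hv hη).1.add (integrable_of_maxFormPot_ne_top_c2 hv hξ).1)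
    ?_ (Eventually.of_forall fun t => ?_)
  · exact ((measurable_periodicInteraction_fromUnitTorusN hv L).ennreal_toReal.aestronglyMeasurable).mul
      (Complex.continuous_re.comp_aestronglyMeasurable
        ((Complex.continuous_conj.comp_aestronglyMeasurable (Lp.aestronglyMeasurable η)).mul
          (Lp.aestronglyMeasurable ξ)))
  · rw [Real.norm_eq_abs, abs_mul, abs_of_nonneg ENNReal.toReal_nonneg, Pi.add_apply, ← mul_add]
    exact mul_le_mul_of_nonneg_left (abs_re_conj_mul_le _ _) ENNReal.toReal_nonneg

/-- **Expansion of the potential part** along a real line, without `W ∈ L¹`: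
`maxFormPot(η + sξ) = maxFormPot η + 2s PotB(η, ξ) + s² maxFormPot ξ`. [folklore] -/
theorem toReal_maxFormPot_add_smul_c2 (hv : Measurable v) {η ξ : L2T N} (hη : maxFormPot v L η ≠ ⊤)
    (hξ : maxFormPot v L ξ ≠ ⊤) (s : ℝ) :
    (maxFormPot v L (η + (s : ℂ) • ξ)).toReal =
      (maxFormPot v L η).toReal + 2 * s * maxFormPotB v L η ξ + s ^ 2 * (maxFormPot v L ξ).toReal := by
  have hfin : maxFormPot v L (η + (s : ℂ) • ξ) ≠ ⊤ := maxFormPot_add_ne_top hv hη (maxFormPot_smul_ne_top _ hξ)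
  have hA : Integrable (fun t : UnitAddTorus (Fin N × Fin 3) =>
      (periodicInteraction v L (fromUnitTorusN L t)).toReal * ‖(η : UnitAddTorus (Fin N × Fin 3) → ℂ) t‖ ^ 2) volume :=
    (integrable_of_maxFormPot_ne_top_c2 hv hη).1
  have hB : Integrable (fun t : UnitAddTorus (Fin N × Fin 3) =>
      2 * s * ((periodicInteraction v L (fromUnitTorusN L t)).toReal *
        (conj ((η : UnitAddTorus (Fin N × Fin 3) → ℂ) t) * (ξ : UnitAddTorus (Fin N × Fin 3) → ℂ) t).re)) volume :=
    (integrable_maxFormPotB_c2 hv hη hξ).const_mul _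
  have hC : Integrable (fun t : UnitAddTorus (Fin N × Fin 3) =>
      s ^ 2 * ((periodicInteraction v L (fromUnitTorusN L t)).toReal * ‖(ξ : UnitAddTorus (Fin N × Fin 3) → ℂ) t‖ ^ 2))
      volume :=
    (integrable_of_maxFormPot_ne_top_c2 hv hξ).1.const_mul _
  have hAB : Integrable (fun t : UnitAddTorus (Fin N × Fin 3) =>
      (periodicInteraction v L (fromUnitTorusN L t)).toReal * ‖(η : UnitAddTorus (Fin N × Fin 3) → ℂ) t‖ ^ 2 +
      2 * s * ((periodicInteraction v L (fromUnitTorusN L t)).toReal *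
        (conj ((η : UnitAddTorus (Fin N × Fin 3) → ℂ) t) * (ξ : UnitAddTorus (Fin N × Fin 3) → ℂ) t).re)) volume :=
    hA.add hB
  rw [(integrable_of_maxFormPot_ne_top_c2 hv hfin).2, (integrable_of_maxFormPot_ne_top_c2 hv hη).2,
    (integrable_of_maxFormPot_ne_top_c2 hv hξ).2, maxFormPotB, ← integral_const_mul, ← integral_const_mul,
    ← integral_add hA hB, ← integral_add hAB hC]
  refine integral_congr_ae ?_
  filter_upwards [Lp.coeFn_add η ((s : ℂ) • ξ), Lp.coeFn_smul (s : ℂ) ξ] with t hadd hsmul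
  rw [hadd, Pi.add_apply, hsmul, Pi.smul_apply, smul_eq_mul, norm_add_ofReal_mul_sq]
  ring

/-- **Expansion of the maximal form** along a real line, without `W ∈ L¹`. [folklore] -/
theorem toReal_maxForm_add_smul_c2 (hv : Measurable v) {η ξ : L2T N} (hη : maxForm v L η ≠ ⊤)
    (hξ : maxForm v L ξ ≠ ⊤) (s : ℝ) :
    maxForm v L (η + (s : ℂ) • ξ) ≠ ⊤ ∧
    (maxForm v L (η + (s : ℂ) • ξ)).toReal = (maxForm v L η).toReal +
      2 * s * (maxFormKinB L η ξ + maxFormPotB v L η ξ) + s ^ 2 * (maxForm v L ξ).toReal := by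
  have hηK : maxFormKin L η ≠ ⊤ := ne_top_of_le_ne_top hη (self_le_add_right _ _)
  have hξK : maxFormKin L ξ ≠ ⊤ := ne_top_of_le_ne_top hξ (self_le_add_right _ _)
  have hηP : maxFormPot v L η ≠ ⊤ := ne_top_of_le_ne_top hη (self_le_add_left _ _)
  have hξP : maxFormPot v L ξ ≠ ⊤ := ne_top_of_le_ne_top hξ (self_le_add_left _ _)
  have hK : maxFormKin L (η + (s : ℂ) • ξ) ≠ ⊤ := maxFormKin_add_ne_top hηK (maxFormKin_smul_ne_top _ hξK)
  have hP : maxFormPot v L (η + (s : ℂ) • ξ) ≠ ⊤ := maxFormPot_add_ne_top hv hηP (maxFormPot_smul_ne_top _ hξP)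
  refine ⟨ENNReal.add_ne_top.2 ⟨hK, hP⟩, ?_⟩
  rw [maxForm, maxForm, maxForm, ENNReal.toReal_add hK hP, ENNReal.toReal_add hηK hηP, ENNReal.toReal_add hξK hξP,
    toReal_maxFormKin_add_smul hηK hξK, toReal_maxFormPot_add_smul_c2 hv hηP hξP]
  ring

/-- A ground state realises the bound: `maxForm v L η = E₀‖η‖²` (finite-range `v`). [folklore] -/
theorem maxForm_eq_of_mem_maxFormGroundStates_c2 (hL : 0 < L) (hvfr : IsRepulsiveFiniteRange v)
    {η : L2T N} (hη : η ∈ maxFormGroundStates v N L) :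
    maxForm v L η = periodicGroundStateEnergy v N L * ENNReal.ofReal (‖η‖ ^ 2) :=
  le_antisymm hη.2 (periodicGroundStateEnergy_mul_le_maxForm_of_mem_fr hL hvfr hη.1)

/-- **First variation (Euler–Lagrange equation) at a ground state of the maximal form, finite-range `v`, no
integrability of `W`**: for `η ∈ maxFormGroundStates v N L` (`E₀ < ⊤`) and a Bose-symmetric `ξ` of finite
maximal form, `KinB(η, ξ) + PotB(η, ξ) = E₀ re⟪η, ξ⟫`. [cite: ReedSimonIV1978, Thm. XIII.1] -/
theorem maxFormKinB_add_maxFormPotB_eq_c2 (hL : 0 < L) (hvfr : IsRepulsiveFiniteRange v)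
    (hE : periodicGroundStateEnergy v N L ≠ ⊤)
    {η ξ : L2T N} (hη : η ∈ maxFormGroundStates v N L) (hξ : ξ ∈ boseSymmetric N) (hξfin : maxForm v L ξ ≠ ⊤) :
    maxFormKinB L η ξ + maxFormPotB v L η ξ = (periodicGroundStateEnergy v N L).toReal * (⟪η, ξ⟫_ℂ).re := by
  set E := periodicGroundStateEnergy v N L with hEdef
  have hηfin : maxForm v L η ≠ ⊤ := maxForm_ne_top_of_mem_maxFormGroundStates hE hη
  have hη0 : (maxForm v L η).toReal = E.toReal * ‖η‖ ^ 2 := by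
    rw [maxForm_eq_of_mem_maxFormGroundStates_c2 hL hvfr hη, ENNReal.toReal_mul, ENNReal.toReal_ofReal (sq_nonneg _)]
  have hline : ∀ s : ℝ, E.toReal * ‖η + (s : ℂ) • ξ‖ ^ 2 ≤ (maxForm v L (η + (s : ℂ) • ξ)).toReal := by
    intro s
    have hmem : η + (s : ℂ) • ξ ∈ boseSymmetric N := (boseSymmetric N).add_mem hη.1 ((boseSymmetric N).smul_mem _ hξ)
    have h := periodicGroundStateEnergy_mul_le_maxForm_of_mem_fr hL hvfr hmem
    have h2 := ENNReal.toReal_mono (toReal_maxForm_add_smul_c2 hvfr.1 hηfin hξfin s).1 h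
    rwa [ENNReal.toReal_mul, ENNReal.toReal_ofReal (sq_nonneg _)] at h2
  have hpoly : ∀ s : ℝ, 0 ≤ ((maxForm v L ξ).toReal - E.toReal * ‖ξ‖ ^ 2) * s ^ 2 +
      (2 * (maxFormKinB L η ξ + maxFormPotB v L η ξ - E.toReal * (⟪η, ξ⟫_ℂ).re)) * s := by
    intro s
    have h := hline s
    rw [(toReal_maxForm_add_smul_c2 hvfr.1 hηfin hξfin s).2, hη0, norm_add_ofReal_smul_sq] at h
    nlinarith [h]
  have h0 := eq_zero_of_forall_sq_add_mul_nonneg hpoly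
  linarith

/-- **The Euler–Lagrange equation of a maximal-form ground state without `W ∈ L¹`, closed form** (registered
sub-goal `toolsEulerLagrange_c2` of the crux item; the statement of `maxFormKinB_add_maxFormPotB_eq_c2` with all
binders explicit). [cite: ReedSimonIV1978, Thm. XIII.1] -/
theorem toolsEulerLagrange_c2 :
    ∀ (N : ℕ) (L : ℝ) (v : ℝ → ℝ≥0∞), 0 < L → IsRepulsiveFiniteRange v → periodicGroundStateEnergy v N L ≠ ⊤ → ∀ η ξ : Lp ℂ 2 (volume : Measure (UnitAddTorus (Fin N × Fin 3))), η ∈ maxFormGroundStates v N L → ξ ∈ boseSymmetric N → maxForm v L ξ ≠ ⊤ → maxFormKinB L η ξ + maxFormPotB v L η ξ = (periodicGroundStateEnergy v N L).toReal * (⟪η, ξ⟫_ℂ).re :=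
  fun _N _L _v hL hvfr hE _η _ξ hη hξ hfin => maxFormKinB_add_maxFormPotB_eq_c2 hL hvfr hE hη hξ hfin

end PartA

/-! ## Part B — the test class `ξ = χ² (|η| + ε)⁻¹` -/

section PartB

/-- The coordinate-Lipschitz bound of the smooth pair cut-off, crude form: along every coordinate line of every
particle, `|χ(t + s𝐞) - χ(t)| ≤ (2 K₀ N / δ) |s|`. [folklore] -/
theorem abs_pairCutoff_add_single_sub_le_crude {K₀ : ℝ≥0} {θ : ℝ → ℝ} (hθ : Torus.IsCutProfile K₀ θ)
    {r δ : ℝ} (hδ : 0 < δ) (q : Fin N × Fin 3) (t : UnitAddTorus (Fin N × Fin 3)) (s : ℝ) :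
    |Torus.pairCutoff (N := N) θ r δ (t + Pi.single q ((s : ℝ) : UnitAddCircle)) - Torus.pairCutoff θ r δ t| ≤
      2 * K₀ * N / δ * |s| := by
  obtain ⟨i, k⟩ := q
  have h := Torus.abs_pairCutoff_add_single_sub_le (N := N) (r := r) hθ hδ i t k s
  have hsum : (∑ j : Fin N, if r + δ - |s| < Torus.pairDist i j t ∧ Torus.pairDist i j t < r + 2 * δ + |s|
      then (1 : ℝ) else 0) ≤ N := by
    calc (∑ j : Fin N, if r + δ - |s| < Torus.pairDist i j t ∧ Torus.pairDist i j t < r + 2 * δ + |s|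
          then (1 : ℝ) else 0) ≤ ∑ _j : Fin N, (1 : ℝ) :=
          Finset.sum_le_sum fun j _ => by split_ifs <;> norm_num
      _ = N := by simp
  have hK : 0 ≤ (K₀ : ℝ) * (|s| / δ) := by positivity
  calc _ ≤ K₀ * (|s| / δ) * (2 * ∑ j : Fin N,
        if r + δ - |s| < Torus.pairDist i j t ∧ Torus.pairDist i j t < r + 2 * δ + |s| then (1 : ℝ) else 0) := h
    _ ≤ K₀ * (|s| / δ) * (2 * N) := mul_le_mul_of_nonneg_left (by linarith) hK
    _ = 2 * K₀ * N / δ * |s| := by field_simp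

/-- Squares of `[0,1]`-valued numbers are `2`-Lipschitz: `|a² - b²| ≤ 2|a - b|`. [folklore] -/
theorem abs_sq_sub_sq_le_two_mul {a b : ℝ} (ha : 0 ≤ a) (ha1 : a ≤ 1) (hb : 0 ≤ b) (hb1 : b ≤ 1) :
    |a ^ 2 - b ^ 2| ≤ 2 * |a - b| := by
  rw [sq_sub_sq, abs_mul]
  calc |a + b| * |a - b| ≤ 2 * |a - b| := by
        refine mul_le_mul_of_nonneg_right ?_ (abs_nonneg _)
        rw [abs_of_nonneg (by linarith)]; linarith
    _ = 2 * |a - b| := rfl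

/-- **The test class.** For a Bose-symmetric `η` of finite kinetic energy, `ε > 0`, a cut profile `θ` and scales
`r`, `δ > 0`, there is a Bose-symmetric class `ξ ∈ L²` with `ξ = χ² (|η| + ε)⁻¹` a.e.
(`χ = Torus.pairCutoff θ r δ`) whose directional spectral energies are all finite (Leibniz rule for the
coordinate-Lipschitz multiplier `χ²`, `Torus.tsum_sq_mul_enorm_mFourierCoeff_mul_le`, applied to the finite-energy
class `(|η| + ε)⁻¹ = invShiftLp + ε⁻¹`). [folklore] -/
theorem exists_testClass (hL : 0 < L) {η : L2T N} (hηsym : η ∈ boseSymmetric N) (hηK : maxFormKin L η ≠ ⊤)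
    {ε : ℝ} (hε : 0 < ε) {K₀ : ℝ≥0} {θ : ℝ → ℝ} (hθ : Torus.IsCutProfile K₀ θ) (r : ℝ) {δ : ℝ} (hδ : 0 < δ) :
    ∃ ξ : L2T N, ξ ∈ boseSymmetric N ∧
      (∀ᵐ t ∂(volume : Measure (UnitAddTorus (Fin N × Fin 3))), (ξ : UnitAddTorus (Fin N × Fin 3) → ℂ) t =
        ((Torus.pairCutoff (N := N) θ r δ t ^ 2 : ℝ) : ℂ) *
          (((‖(η : UnitAddTorus (Fin N × Fin 3) → ℂ) t‖ + ε)⁻¹ : ℝ) : ℂ)) ∧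
      ∀ p : Fin N × Fin 3, ∑' n : Fin N × Fin 3 → ℤ, ENNReal.ofReal ((n p : ℝ) ^ 2) *
        ‖mFourierCoeff (ξ : UnitAddTorus (Fin N × Fin 3) → ℂ) n‖ₑ ^ 2 ≠ ⊤ := by
  -- the class `ρ = (|η| + ε)⁻¹`
  set ρ : L2T N := invShiftLp hε η + ((ε⁻¹ : ℝ) : ℂ) • (mFourierLp 2 (0 : Fin N × Fin 3 → ℤ) : L2T N) with hρ
  have hρsym : ρ ∈ boseSymmetric N :=
    (boseSymmetric N).add_mem (invShiftLp_mem_boseSymmetric hε hηsym)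
      ((boseSymmetric N).smul_mem _ mFourierLp_zero_mem_boseSymmetric)
  have hρK : maxFormKin L ρ ≠ ⊤ := by
    rw [hρ, maxFormKin_add_smul_mFourierLp_zero]
    exact maxFormKin_invShiftLp_ne_top hε hηK
  have hρae := coeFn_invShiftLp_add hε η
  -- the multiplier `χ²` (an opaque local name for the cut-off, to keep unification cheap)
  obtain ⟨χ, hχdef⟩ : ∃ χ : UnitAddTorus (Fin N × Fin 3) → ℝ, χ = Torus.pairCutoff (N := N) θ r δ := ⟨_, rfl⟩
  rw [← hχdef]
  have hχc : Continuous fun t => χ t ^ 2 := by rw [hχdef]; exact (Torus.continuous_pairCutoff hθ r δ).pow 2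
  have hχ0 : ∀ t, 0 ≤ χ t := fun t => by rw [hχdef]; exact Torus.pairCutoff_nonneg hθ r δ t
  have hχ1 : ∀ t, χ t ≤ 1 := fun t => by rw [hχdef]; exact Torus.pairCutoff_le_one hθ r δ t
  have hχb : ∀ t, |χ t ^ 2| ≤ 1 := fun t => by
    rw [abs_of_nonneg (sq_nonneg _)]
    exact pow_le_one₀ (hχ0 t) (hχ1 t)
  have hχσ : ∀ (σ : Equiv.Perm (Fin N)) (t : UnitAddTorus (Fin N × Fin 3)),
      (fun t => χ t ^ 2) (fun p : Fin N × Fin 3 => t (σ p.1, p.2)) = χ t ^ 2 := fun σ t => by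
    simp only [hχdef, Torus.pairCutoff_comp_perm]
  have hχL : ∀ (q : Fin N × Fin 3) (t : UnitAddTorus (Fin N × Fin 3)) (s : ℝ),
      |χ (t + Pi.single q ((s : ℝ) : UnitAddCircle)) - χ t| ≤ 2 * K₀ * N / δ * |s| := fun q t s => by
    rw [hχdef]; exact abs_pairCutoff_add_single_sub_le_crude hθ hδ q t s
  refine ⟨(memLp_mul_of_abs_le_one hχc hχb ρ).toLp _, toLp_mul_mem_boseSymmetric hχc hχb ρ hχσ hρsym, ?_, ?_⟩
  · have h1 := coeFn_toLp_mul hχc hχb ρ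
    rw [Torus.volume_eq_pi_haarAddCircle] at h1
    filter_upwards [h1, hρae] with t ht hρt
    rw [ht, hρt]
  · intro p
    rw [funext fun n => congrArg (fun z => ENNReal.ofReal ((n p : ℝ) ^ 2) * ‖z‖ₑ ^ 2) (mFourierCoeff_toLp_mul hχc hχb ρ n)]
    -- Leibniz rule for the multiplier `χ²` (`1`-bounded, `(4K₀N/δ)`-Lipschitz along `p`)
    set Kχ : ℝ := 2 * K₀ * N / δ with hKχ
    have hKχ0 : 0 ≤ Kχ := by rw [hKχ]; positivity
    have hglob : MemLp (ρ : UnitAddTorus (Fin N × Fin 3) → ℂ) 2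
        (volume : Measure (UnitAddTorus (Fin N × Fin 3))) := Lp.memLp ρ
    have hmeas : AEStronglyMeasurable (fun t : UnitAddTorus (Fin N × Fin 3) => ((χ t ^ 2 : ℝ) : ℂ))
        (Measure.pi fun _ : Fin N × Fin 3 => (AddCircle.haarAddCircle : Measure UnitAddCircle)) :=
      (Complex.continuous_ofReal.comp hχc).aestronglyMeasurable
    have hB : ∀ x, ‖((χ x ^ 2 : ℝ) : ℂ)‖ ≤ (1 : ℝ≥0) := fun x => by
      rw [Complex.norm_real, Real.norm_eq_abs, NNReal.coe_one]; exact hχb x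
    have hΛ : ∀ (x : UnitAddTorus (Fin N × Fin 3)) (s : ℝ), |s| ≤ 1 →
        ‖((χ (x + Pi.single p ((s : ℝ) : UnitAddCircle)) ^ 2 : ℝ) : ℂ) - ((χ x ^ 2 : ℝ) : ℂ)‖ₑ ≤
          ENNReal.ofReal |s| * ENNReal.ofReal (2 * Kχ) := by
      intro x s _
      rw [← Complex.ofReal_sub, ← ofReal_norm, Complex.norm_real, Real.norm_eq_abs,
        ← ENNReal.ofReal_mul (abs_nonneg _)]
      refine ENNReal.ofReal_le_ofReal ?_
      have hx0 := hχ0 (x + Pi.single p ((s : ℝ) : UnitAddCircle))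
      have hx1 := hχ1 (x + Pi.single p ((s : ℝ) : UnitAddCircle))
      have hl := hχL p x s
      calc |χ (x + Pi.single p ((s : ℝ) : UnitAddCircle)) ^ 2 - χ x ^ 2|
          ≤ 2 * |χ (x + Pi.single p ((s : ℝ) : UnitAddCircle)) - χ x| :=
            abs_sq_sub_sq_le_two_mul hx0 hx1 (hχ0 x) (hχ1 x)
        _ ≤ 2 * (Kχ * |s|) := by
            refine mul_le_mul_of_nonneg_left ?_ (by norm_num)
            rw [hKχ]
            exact hl
        _ = |s| * (2 * Kχ) := by ring
    have hmul := Torus.tsum_sq_mul_enorm_mFourierCoeff_mul_le (d := Fin N × Fin 3)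
      (by rw [Torus.volume_eq_pi_haarAddCircle]; exact hmeas) hB
      (memLp_piHaar_iff.1 (memLp_piHaar_of_memLp hglob)) p one_pos hΛ one_pos
    rw [Torus.volume_eq_pi_haarAddCircle] at hmul
    refine ne_top_of_le_ne_top ?_ hmul
    refine ENNReal.add_ne_top.2 ⟨?_, ?_⟩
    · refine ENNReal.mul_ne_top (ENNReal.mul_ne_top ENNReal.ofReal_ne_top (ENNReal.pow_ne_top ENNReal.coe_ne_top)) ?_
      exact tsum_dir_ne_top hL hρK p
    · refine ENNReal.mul_ne_top (ENNReal.mul_ne_top ENNReal.ofReal_ne_top ENNReal.ofReal_ne_top) ?_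
      rw [lintegral_const_mul' _ _ (ENNReal.pow_ne_top ENNReal.ofReal_ne_top)]
      refine ENNReal.mul_ne_top (ENNReal.pow_ne_top ENNReal.ofReal_ne_top) ?_
      have h3 := (norm_Lp_two_sq_eq_toReal ρ).2
      simp only [enorm_eq_nnnorm]
      exact h3

end PartB

/-! ## Part D — the interaction is bounded on the support of the cut-off -/

section PartD

/-- **`W` is bounded where the cut-off does not vanish.** For a finite-range `v` (`v = 0` beyond `R₀`,
`2R₀ < L`: nearest image) that is bounded on `(δ', ∞)` for every `δ' > 0`, and the pair cut-off at scales
`r, δ > 0`: on `{χ ≠ 0}` all nearest-image pair distances exceed `r + δ`, so every pair term of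
`W = ∑_{i<j} v^per(xᵢ - xⱼ)` is at most the bound of `v` on `(L(r+δ)/2, ∞)`, and `W ≤ N² · M`. [folklore] -/
theorem exists_periodicInteraction_le_of_pairCutoff_ne_zero (hvm : Measurable v)
    (hlb : ∀ δ' : ℝ, 0 < δ' → ∃ M : ℝ≥0∞, M ≠ ⊤ ∧ ∀ r' : ℝ, δ' < r' → v r' ≤ M)
    {R₀ : ℝ} (hR₀ : ∀ r', R₀ < r' → v r' = 0) (hL : 0 < L) (h2R : 2 * R₀ < L)
    {K₀ : ℝ≥0} {θ : ℝ → ℝ} (hθ : Torus.IsCutProfile K₀ θ) {r δ : ℝ} (hr : 0 < r) (hδ : 0 < δ) :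
    ∃ M : ℝ≥0∞, M ≠ ⊤ ∧ ∀ t : UnitAddTorus (Fin N × Fin 3), Torus.pairCutoff (N := N) θ r δ t ≠ 0 →
      periodicInteraction v L (fromUnitTorusN L t) ≤ M := by
  have _ := hvm
  obtain ⟨M, hM, hvM⟩ := hlb (L * (r + δ) / 2) (by positivity)
  refine ⟨(N : ℝ≥0∞) * ((N : ℝ≥0∞) * M), ENNReal.mul_ne_top (ENNReal.natCast_ne_top N)
    (ENNReal.mul_ne_top (ENNReal.natCast_ne_top N) hM), fun t ht => ?_⟩
  -- all pairs are farther than `r + δ`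
  have hfar : ∀ i j : Fin N, i ≠ j → r + δ < Torus.pairDist i j t := by
    intro i j hij
    by_contra hle
    exact ht (Torus.pairCutoff_eq_zero_of_ne hθ hδ hij (not_lt.1 hle))
  -- each pair term is at most `M`
  set X : Config N := fromUnitTorusN L t with hX
  have hterm : ∀ i j : Fin N, i ≠ j → periodizedPotential v L (X i - X j) ≤ M := by
    intro i j hij
    obtain ⟨n₀, hn₀⟩ := exists_periodizedPotential_eq_single hR₀ h2R hL (X i - X j)
    rw [hn₀]
    refine hvM _ ?_
    have hge := norm_sub_sub_latticeVec_ge hL.le t i j n₀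
    have hlt : L * (r + δ) / 2 < L * Torus.pairDist i j t := by
      have h1 : L * (r + δ) < L * Torus.pairDist i j t := mul_lt_mul_of_pos_left (hfar i j hij) hL
      have h2 : 0 < L * (r + δ) := by positivity
      linarith
    rw [hX]
    exact hlt.trans_le hge
  calc periodicInteraction v L X
      = ∑ i : Fin N, ∑ j ∈ (Finset.univ : Finset (Fin N)).filter (fun j => i < j),
          periodizedPotential v L (X i - X j) := rfl
    _ ≤ ∑ i : Fin N, ∑ j ∈ (Finset.univ : Finset (Fin N)).filter (fun j => i < j), M :=
        Finset.sum_le_sum fun i _ => Finset.sum_le_sum fun j hj =>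
          hterm i j (ne_of_lt (Finset.mem_filter.1 hj).2)
    _ ≤ ∑ _i : Fin N, ∑ _j : Fin N, M :=
        Finset.sum_le_sum fun i _ => Finset.sum_le_sum_of_subset (Finset.filter_subset _ _)
    _ = (N : ℝ≥0∞) * ((N : ℝ≥0∞) * M) := by
        simp only [Finset.sum_const, Finset.card_univ, Fintype.card_fin, nsmul_eq_mul]

end PartD

end Summit.AtomisticToContinuum.BoseEinsteinCondensation.Cruxes.HardCoreExtension.ThirdLawCurrentFloorAlt

end
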